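import Literature.AlgebraicGeometry.Motives.AbelianVarietyLevelAdjointCalculus
import HarnessLib

/-!
# Level adjoints between TWO biproducts of abelian varieties with product pairings: the adjoint of a matrix entry is the transposed entry

Layer `Literature/AlgebraicGeometry/Motives`, namespace `Literature.AlgebraicGeometry.Motives.AbelianVariety`.  THEOREMS ONLY (no
definition, no named fact, no instance, no `sorry`); sequel of ★ `AbelianVarietyLevelAdjointCalculus` (p761351), whose §4
`levelAdjoint_fan_entry` is the one-biproduct case.  Cell `hodgecm-mathlib` (D-0151), fan A, count-neutral capital for the d6 `stub_RosH` piece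
(L) (A-plan2 (g12) 2026-08-30T04:34:10Z): a push–pull WORD `t ≫ Σ_γ Alb(T_γ)` (★ (P3)) on the complex model `Y_K = ⊞_c J(E′_{K,c})` passes
THROUGH the model of a deeper level `Y_N = ⊞_{c′} J(E′_{N,c′})`; its letters are matrix entries BETWEEN two biproducts, each carrying the
product pairing of its pieces' theta divisors (`hpair`, the field of A-p02 (g14)'s `GSComplexModel`).  HC_CM is proved only modulo the 7
printed citations until rung 0 closes; nothing here is specific to it.

* §1 **`levelAdjoint_fan_entry₂`** — fans `(π, ι)` on `Y` over `J : C → _` and `(π′, ι′)` on `Y′` over `J′ : C′ → _`, product pairings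
  `ē^{Θ} = ∏_c ē^{W c} ∘ π_c`, `ē^{Θ′} = ∏_{c′} ē^{W′ c′} ∘ π′_{c′}`; if `(f, f†)` is a level adjoint pair of weight `d` for `(W c, W′ c′)`
  (`f : J c → J′ c′`) then the entry `π c ≫ f ≫ ι′ c′ : Y → Y′` has the adjoint `π′ c′ ≫ f† ≫ ι c : Y′ → Y` of weight `d` for `(Θ, Θ′)`.
* §2 `fan_matrix_comp` — the product of a column-indexed matrix `Y → Y′` and a row-indexed matrix `Y′ → Y″` through the middle fan is the
  entrywise composite (the shape of `t ≫ Σ_γ Alb(T_γ)` through a deeper level); **`levelAdjoint_fan_sum`** — a finite sum of entries of ONE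
  biproduct with entrywise adjoints of one weight has the sum of the transposed adjoints (★ `levelAdjoint_fan_entry` + ★ `levelAdjoint_sum`).
* §3 (ed. 2) WEIGHT EQUALISATION — `levelAdjoint_weight_eq` (a pair of weight `w` with `m * w = D` is a pair of weight `D` after scaling
  the adjoint by `m`), **`levelAdjoint_fan_sum_weighted`** (entrywise adjoints of DIFFERENT weights `w i` with `m i * w i = D` on `s`: the
  sum of entries has the adjoint `Σ_i π (b i) ≫ (m i • g i) ≫ ι (a i)` of the uniform weight `D`) and **`levelAdjoint_fan_sum_smul`** (when
  each raw adjoint is itself `w i • g i` — the shape of the dominated-cover letter ★ `levelAdjoint_pushforward_of_dominated` — the adjoint of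
  the sum is `D • Σ_i π (b i) ≫ g i ≫ ι (a i)`, ONE scalar in front of the transposed word).
* §4 (ed. 3) ENTRIES OF A PUSH–PULL WORD — `levelAdjoint_one_of_plain` (a plainly stated adjoint identity `ē(x P, Q) = ē(P, y Q)` is
  a pair of weight `1`), **`levelAdjoint_comp_plain_weighted`** (a plain letter `(x₁, y₁)` followed by a weighted letter `(x₂, y₂)` of
  weight `w` is the pair `(x₁ ≫ x₂, y₂ ≫ y₁)` of the SAME weight `w` — the entry `q^* ≫ Nm_{T_γ}` of a Hecke push–pull word: Galois
  letter then dominated-cover letter ★ `levelAdjoint_pushforward_of_dominated'`, ready for `levelAdjoint_fan_sum_weighted`) and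
  `levelAdjoint_comp₃_smul` (two plain letters then `(x₃, w′ • y₃)` of weight `w`: the pair `(x₁ ≫ x₂ ≫ x₃, w′ • (y₃ ≫ y₂ ≫ y₁))`).

## References
* [MumfordAV1970] D. Mumford, *Abelian Varieties* (1970), §20 (p. 186, property (3) of `e_n`; the Riemann form of `L₁ ⊠ L₂`) and §21.
* [Lang1983AbelianVarieties] S. Lang, *Abelian Varieties* (1983), Ch. VII §2 Prop. 3.
-/

set_option autoImplicit false

universe u

open CategoryTheory CategoryTheory.Limits AlgebraicGeometry

noncomputable section

namespace Literature.AlgebraicGeometry.Motives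

namespace AbelianVariety

variable {K : Type u} [Field K]

/-- **ENTRIES BETWEEN TWO BIPRODUCTS**: `Y = ⊞_c J c` (fan `π, ι`), `Y′ = ⊞_{c′} J′ c′` (fan `π′, ι′`), divisors `Θ` on `Y`, `Θ′` on `Y′` with
PRODUCT level pairings through the pieces (`hpair`, `hpair′`).  If `(f, f†)` is a level adjoint pair of weight `d` for `(W c, W′ c′)`, then
`(π c ≫ f ≫ ι′ c′, π′ c′ ≫ f† ≫ ι c)` is a level adjoint pair of weight `d` for `(Θ, Θ′)` («transposed matrix of adjoints» for orthogonal sums).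
[cite: MumfordAV1970, §20 (p. 186, property (3) of e_n) and §21] [cite: Lang1983AbelianVarieties, Ch. VII §2 Prop. 3] -/
theorem levelAdjoint_fan_entry₂ {C C' : Type*} [Fintype C] [Fintype C'] {J : C → AbelianVariety K} {J' : C' → AbelianVariety K}
    {Y Y' : AbelianVariety K}
    (π : ∀ c, Y ⟶ J c) (ι : ∀ c, J c ⟶ Y) (hιπ : ∀ c, ι c ≫ π c = 𝟙 (J c)) (hιπ' : ∀ c₁ c₂, c₁ ≠ c₂ → ι c₁ ≫ π c₂ = 0)
    (π' : ∀ c', Y' ⟶ J' c') (ι' : ∀ c', J' c' ⟶ Y') (hιπ'₁ : ∀ c', ι' c' ≫ π' c' = 𝟙 (J' c'))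
    (hιπ'₂ : ∀ c₁ c₂, c₁ ≠ c₂ → ι' c₁ ≫ π' c₂ = 0)
    (W : ∀ c, CartierDivisor (J c).X.left) (W' : ∀ c', CartierDivisor (J' c').X.left)
    (Θ : CartierDivisor Y.X.left) (Θ' : CartierDivisor Y'.X.left)
    (hpair : ∀ (N : ℕ) [IsDominant (Hom.toSchemeHom ((N : ℤ) • 𝟙 Y))] [∀ c, IsDominant (Hom.toSchemeHom ((N : ℤ) • 𝟙 (J c)))]
      (P Q : Y.torsionPoints K N),
      Y.weilPairingLevel Θ P Q =
        ∏ c, (J c).weilPairingLevel (W c) ⟨AlgPoints.map (π c).hom.hom.hom P.1, map_mem_torsionPoints (π c) P.2⟩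
          ⟨AlgPoints.map (π c).hom.hom.hom Q.1, map_mem_torsionPoints (π c) Q.2⟩)
    (hpair' : ∀ (N : ℕ) [IsDominant (Hom.toSchemeHom ((N : ℤ) • 𝟙 Y'))] [∀ c', IsDominant (Hom.toSchemeHom ((N : ℤ) • 𝟙 (J' c')))]
      (P Q : Y'.torsionPoints K N),
      Y'.weilPairingLevel Θ' P Q =
        ∏ c', (J' c').weilPairingLevel (W' c') ⟨AlgPoints.map (π' c').hom.hom.hom P.1, map_mem_torsionPoints (π' c') P.2⟩
          ⟨AlgPoints.map (π' c').hom.hom.hom Q.1, map_mem_torsionPoints (π' c') Q.2⟩)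
    {c : C} {c' : C'} {f : J c ⟶ J' c'} {fd : J' c' ⟶ J c} {d : ℕ}
    (hf : ∀ (N : ℕ) [IsDominant (Hom.toSchemeHom ((N : ℤ) • 𝟙 (J c)))] [IsDominant (Hom.toSchemeHom ((N : ℤ) • 𝟙 (J' c')))]
      (P : (J c).torsionPoints K N) (Q : (J' c').torsionPoints K N),
      (J' c').weilPairingLevel (W' c') ⟨AlgPoints.map ((d : ℤ) • f).hom.hom.hom P.1, map_mem_torsionPoints ((d : ℤ) • f) P.2⟩ Q =
        (J c).weilPairingLevel (W c) P ⟨AlgPoints.map fd.hom.hom.hom Q.1, map_mem_torsionPoints fd Q.2⟩)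
    (N : ℕ) [IsDominant (Hom.toSchemeHom ((N : ℤ) • 𝟙 Y))] [IsDominant (Hom.toSchemeHom ((N : ℤ) • 𝟙 Y'))]
    [∀ c, IsDominant (Hom.toSchemeHom ((N : ℤ) • 𝟙 (J c)))] [∀ c', IsDominant (Hom.toSchemeHom ((N : ℤ) • 𝟙 (J' c')))]
    (P : Y.torsionPoints K N) (Q : Y'.torsionPoints K N) :
    Y'.weilPairingLevel Θ' ⟨AlgPoints.map ((d : ℤ) • (π c ≫ f ≫ ι' c')).hom.hom.hom P.1, map_mem_torsionPoints ((d : ℤ) • (π c ≫ f ≫ ι' c')) P.2⟩ Q =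
      Y.weilPairingLevel Θ P ⟨AlgPoints.map (π' c' ≫ fd ≫ ι c).hom.hom.hom Q.1, map_mem_torsionPoints (π' c' ≫ fd ≫ ι c) Q.2⟩ := by
  classical
  rw [hpair', hpair]
  rw [Finset.prod_eq_single c' (fun c'' _ hne => ?_) (fun h => absurd (Finset.mem_univ c') h),
    Finset.prod_eq_single c (fun c'' _ hne => ?_) (fun h => absurd (Finset.mem_univ c) h)]
  · have eL : (⟨AlgPoints.map (π' c').hom.hom.hom (AlgPoints.map ((d : ℤ) • (π c ≫ f ≫ ι' c')).hom.hom.hom P.1),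
          map_mem_torsionPoints (π' c') (map_mem_torsionPoints ((d : ℤ) • (π c ≫ f ≫ ι' c')) P.2)⟩ : (J' c').torsionPoints K N) =
        ⟨AlgPoints.map ((d : ℤ) • f).hom.hom.hom (AlgPoints.map (π c).hom.hom.hom P.1),
          map_mem_torsionPoints ((d : ℤ) • f) (map_mem_torsionPoints (π c) P.2)⟩ :=
      Subtype.ext (show AlgPoints.map (π' c').hom.hom.hom (AlgPoints.map ((d : ℤ) • (π c ≫ f ≫ ι' c')).hom.hom.hom P.1) =
          AlgPoints.map ((d : ℤ) • f).hom.hom.hom (AlgPoints.map (π c).hom.hom.hom P.1) by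
        rw [← map_hom_comp_apply, ← map_hom_comp_apply, Preadditive.zsmul_comp, Category.assoc, Category.assoc, hιπ'₁ c',
          Category.comp_id, Preadditive.comp_zsmul])
    have eR : (⟨AlgPoints.map (π c).hom.hom.hom (AlgPoints.map (π' c' ≫ fd ≫ ι c).hom.hom.hom Q.1),
          map_mem_torsionPoints (π c) (map_mem_torsionPoints (π' c' ≫ fd ≫ ι c) Q.2)⟩ : (J c).torsionPoints K N) =
        ⟨AlgPoints.map fd.hom.hom.hom (AlgPoints.map (π' c').hom.hom.hom Q.1),
          map_mem_torsionPoints fd (map_mem_torsionPoints (π' c') Q.2)⟩ :=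
      Subtype.ext (show AlgPoints.map (π c).hom.hom.hom (AlgPoints.map (π' c' ≫ fd ≫ ι c).hom.hom.hom Q.1) =
          AlgPoints.map fd.hom.hom.hom (AlgPoints.map (π' c').hom.hom.hom Q.1) by
        rw [← map_hom_comp_apply, ← map_hom_comp_apply, Category.assoc, Category.assoc, hιπ c, Category.comp_id])
    rw [eL, eR]
    exact hf N ⟨_, map_mem_torsionPoints (π c) P.2⟩ ⟨_, map_mem_torsionPoints (π' c') Q.2⟩
  · have e1 : (⟨AlgPoints.map (π c'').hom.hom.hom (AlgPoints.map (π' c' ≫ fd ≫ ι c).hom.hom.hom Q.1),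
          map_mem_torsionPoints (π c'') (map_mem_torsionPoints (π' c' ≫ fd ≫ ι c) Q.2)⟩ : (J c'').torsionPoints K N) = 1 :=
      Subtype.ext (show AlgPoints.map (π c'').hom.hom.hom (AlgPoints.map (π' c' ≫ fd ≫ ι c).hom.hom.hom Q.1) = 1 by
        rw [← map_hom_comp_apply, Category.assoc, Category.assoc, hιπ' c c'' (Ne.symm hne), comp_zero, comp_zero]
        exact map_hom_zero_apply Q.1)
    rw [e1, weilPairingLevel_one_right]
  · have e1 : (⟨AlgPoints.map (π' c'').hom.hom.hom (AlgPoints.map ((d : ℤ) • (π c ≫ f ≫ ι' c')).hom.hom.hom P.1),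
          map_mem_torsionPoints (π' c'') (map_mem_torsionPoints ((d : ℤ) • (π c ≫ f ≫ ι' c')) P.2)⟩ : (J' c'').torsionPoints K N) = 1 :=
      Subtype.ext (show AlgPoints.map (π' c'').hom.hom.hom (AlgPoints.map ((d : ℤ) • (π c ≫ f ≫ ι' c')).hom.hom.hom P.1) = 1 by
        rw [← map_hom_comp_apply, Preadditive.zsmul_comp, Category.assoc, Category.assoc, hιπ'₂ c' c'' (Ne.symm hne), comp_zero,
          comp_zero, smul_zero]
        exact map_hom_zero_apply P.1)
    rw [e1, weilPairingLevel_one_left]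

/-! ## §2 Words: composing two fan matrices through an intermediate biproduct, and the adjoint of a sum of entries -/

/-- **PRODUCT OF FAN MATRICES** (pure biproduct algebra): a matrix `Y → Y′` with one entry per COLUMN `c′` (entry `f c′ : J (a c′) → J′ c′`
placed at `(a c′, c′)`) followed by a matrix `Y′ → Y″` with one entry per ROW `c′` (entry `g c′ : J′ c′ → J″ (b c′)` at `(c′, b c′)`) is the
matrix `Y → Y″` with entries `f c′ ≫ g c′` at `(a c′, b c′)` — the off-diagonal products vanish by `ι′ c₁ ≫ π′ c₂ = 0`.  (The shape of a
push–pull word `t ≫ Σ_γ Alb(T_γ)` through the model of a deeper level: `t` has one entry per deeper piece, so does each `Alb(T_γ)`.)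
[cite: MumfordAV1970, §19 (Hom(X,Y), first paragraph)] -/
theorem fan_matrix_comp {C' : Type*} [Fintype C'] [DecidableEq C'] {C C'' : Type*} {J : C → AbelianVariety K} {J' : C' → AbelianVariety K}
    {J'' : C'' → AbelianVariety K} {Y Y' Y'' : AbelianVariety K}
    (π : ∀ c, Y ⟶ J c) (ι' : ∀ c', J' c' ⟶ Y') (π' : ∀ c', Y' ⟶ J' c') (ι'' : ∀ c'', J'' c'' ⟶ Y'')
    (hιπ'₁ : ∀ c', ι' c' ≫ π' c' = 𝟙 (J' c')) (hιπ'₂ : ∀ c₁ c₂, c₁ ≠ c₂ → ι' c₁ ≫ π' c₂ = 0)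
    (a : C' → C) (b : C' → C'') (f : ∀ c', J (a c') ⟶ J' c') (g : ∀ c', J' c' ⟶ J'' (b c')) :
    (∑ c', π (a c') ≫ f c' ≫ ι' c') ≫ (∑ c', π' c' ≫ g c' ≫ ι'' (b c')) = ∑ c', π (a c') ≫ (f c' ≫ g c') ≫ ι'' (b c') := by
  rw [Preadditive.sum_comp]
  refine Finset.sum_congr rfl fun c₁ _ => ?_
  rw [Preadditive.comp_sum]
  rw [Finset.sum_eq_single c₁ (fun c₂ _ hne => ?_) (fun h => absurd (Finset.mem_univ c₁) h)]
  · simp only [Category.assoc]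
    rw [← Category.assoc (ι' c₁) (π' c₁), hιπ'₁ c₁, Category.id_comp]
  · simp only [Category.assoc]
    rw [← Category.assoc (ι' c₁) (π' c₂), hιπ'₂ c₁ c₂ (Ne.symm hne), zero_comp, comp_zero, comp_zero]

/-- **THE ADJOINT OF A SUM OF ENTRIES (one biproduct, one weight)**: if `Y = ⊞_c J c` carries the product pairing `hpair` and, for a finite
family of entries `π (a i) ≫ f i ≫ ι (b i)` (`f i : J (a i) → J (b i)`), each `(f i, f† i)` is a level adjoint pair of the SAME weight `d` for
`(W (a i), W (b i))`, then the word `Σ_i π (a i) ≫ f i ≫ ι (b i)` has the level adjoint `Σ_i π (b i) ≫ f† i ≫ ι (a i)` of weight `d` for `(Θ, Θ)`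
— ★ `levelAdjoint_fan_entry` entrywise + ★ `levelAdjoint_sum`.  This is the shape in which the d6 piece (L) reads «the adjoint of the
push–pull word of `T_g` is the reversed word (of `T_{g⁻¹}`)» once each entry՚s adjoint is supplied by (F-P2) (★ `levelAdjoint_pushPull`, ★
`Jacobian.weilPairingLevel_pushforward_inv_eq`). [cite: MumfordAV1970, §20 (p. 186, property (3) of e_n) and §21] [cite: Lang1983AbelianVarieties, Ch. VII §2 Prop. 3] -/
theorem levelAdjoint_fan_sum {C : Type*} [Fintype C] {J : C → AbelianVariety K} {Y : AbelianVariety K}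
    (π : ∀ c, Y ⟶ J c) (ι : ∀ c, J c ⟶ Y) (hιπ : ∀ c, ι c ≫ π c = 𝟙 (J c)) (hιπ' : ∀ c₁ c₂, c₁ ≠ c₂ → ι c₁ ≫ π c₂ = 0)
    (W : ∀ c, CartierDivisor (J c).X.left) (Θ : CartierDivisor Y.X.left)
    (hpair : ∀ (N : ℕ) [IsDominant (Hom.toSchemeHom ((N : ℤ) • 𝟙 Y))] [∀ c, IsDominant (Hom.toSchemeHom ((N : ℤ) • 𝟙 (J c)))]
      (P Q : Y.torsionPoints K N),
      Y.weilPairingLevel Θ P Q =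
        ∏ c, (J c).weilPairingLevel (W c) ⟨AlgPoints.map (π c).hom.hom.hom P.1, map_mem_torsionPoints (π c) P.2⟩
          ⟨AlgPoints.map (π c).hom.hom.hom Q.1, map_mem_torsionPoints (π c) Q.2⟩)
    {I : Type*} (s : Finset I) (a b : I → C) (f : ∀ i, J (a i) ⟶ J (b i)) (fd : ∀ i, J (b i) ⟶ J (a i)) {d : ℕ}
    (hf : ∀ i ∈ s, ∀ (N : ℕ) [IsDominant (Hom.toSchemeHom ((N : ℤ) • 𝟙 (J (a i))))] [IsDominant (Hom.toSchemeHom ((N : ℤ) • 𝟙 (J (b i))))]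
      (P : (J (a i)).torsionPoints K N) (Q : (J (b i)).torsionPoints K N),
      (J (b i)).weilPairingLevel (W (b i)) ⟨AlgPoints.map ((d : ℤ) • f i).hom.hom.hom P.1, map_mem_torsionPoints ((d : ℤ) • f i) P.2⟩ Q =
        (J (a i)).weilPairingLevel (W (a i)) P ⟨AlgPoints.map (fd i).hom.hom.hom Q.1, map_mem_torsionPoints (fd i) Q.2⟩)
    (hY : ∀ (N : ℕ) [IsDominant (Hom.toSchemeHom ((N : ℤ) • 𝟙 Y))], ∀ c, IsDominant (Hom.toSchemeHom ((N : ℤ) • 𝟙 (J c))))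
    (N : ℕ) [IsDominant (Hom.toSchemeHom ((N : ℤ) • 𝟙 Y))] (P Q : Y.torsionPoints K N) :
    Y.weilPairingLevel Θ
        ⟨AlgPoints.map ((d : ℤ) • ∑ i ∈ s, π (a i) ≫ f i ≫ ι (b i)).hom.hom.hom P.1,
          map_mem_torsionPoints ((d : ℤ) • ∑ i ∈ s, π (a i) ≫ f i ≫ ι (b i)) P.2⟩ Q =
      Y.weilPairingLevel Θ P
        ⟨AlgPoints.map (∑ i ∈ s, π (b i) ≫ fd i ≫ ι (a i)).hom.hom.hom Q.1, map_mem_torsionPoints (∑ i ∈ s, π (b i) ≫ fd i ≫ ι (a i)) Q.2⟩ := by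
  refine levelAdjoint_sum Θ Θ s (x := fun i => π (a i) ≫ f i ≫ ι (b i)) (y := fun i => π (b i) ≫ fd i ≫ ι (a i))
    (fun i hi N _ _ P Q => ?_) N P Q
  haveI := hY N
  exact levelAdjoint_fan_entry π ι hιπ hιπ' W Θ hpair (hf i hi) N P Q

/-! ### §3 (ed. 2) Weight equalisation: entrywise adjoints of different weights, one uniform weight for the sum -/

/-- **Weight equalisation.**  If `(x, y)` is a level adjoint pair of weight `w` for `(Θ_A, Θ_B)` and `m * w = D`, then `(x, m • y)` is a
level adjoint pair of weight `D` (★ `levelAdjoint_weight_mul`, transported along `m * w = D`). [cite: MumfordAV1970, §20 (p. 186,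
property (3) of e_n)] -/
theorem levelAdjoint_weight_eq {A B : AbelianVariety K} (ΘA : CartierDivisor A.X.left) (ΘB : CartierDivisor B.X.left)
    {x : A ⟶ B} {y : B ⟶ A} {w m D : ℕ} (hm : m * w = D)
    (h : ∀ (N : ℕ) [IsDominant (Hom.toSchemeHom ((N : ℤ) • 𝟙 A))] [IsDominant (Hom.toSchemeHom ((N : ℤ) • 𝟙 B))]
      (P : A.torsionPoints K N) (Q : B.torsionPoints K N),
      B.weilPairingLevel ΘB ⟨AlgPoints.map ((w : ℤ) • x).hom.hom.hom P.1, map_mem_torsionPoints ((w : ℤ) • x) P.2⟩ Q =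
        A.weilPairingLevel ΘA P ⟨AlgPoints.map y.hom.hom.hom Q.1, map_mem_torsionPoints y Q.2⟩)
    (N : ℕ) [IsDominant (Hom.toSchemeHom ((N : ℤ) • 𝟙 A))] [IsDominant (Hom.toSchemeHom ((N : ℤ) • 𝟙 B))]
    (P : A.torsionPoints K N) (Q : B.torsionPoints K N) :
    B.weilPairingLevel ΘB ⟨AlgPoints.map ((D : ℤ) • x).hom.hom.hom P.1, map_mem_torsionPoints ((D : ℤ) • x) P.2⟩ Q =
      A.weilPairingLevel ΘA P ⟨AlgPoints.map ((m : ℤ) • y).hom.hom.hom Q.1, map_mem_torsionPoints ((m : ℤ) • y) Q.2⟩ := by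
  subst hm
  exact levelAdjoint_weight_mul ΘA ΘB h m N P Q

/-- **Fan sum with entrywise weights.**  As ★ `levelAdjoint_fan_sum`, but entry `i` is given with an adjoint `g i` of its OWN weight
`w i`; if `m i * w i = D` for every `i ∈ s`, the sum `Σ_{i ∈ s} π (a i) ≫ f i ≫ ι (b i)` has the adjoint
`Σ_{i ∈ s} π (b i) ≫ (m i • g i) ≫ ι (a i)` of the uniform weight `D` (★ `levelAdjoint_weight_eq` entrywise, then ★
`levelAdjoint_fan_sum`). [cite: MumfordAV1970, §20 (p. 186, property (3) of e_n)] -/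
theorem levelAdjoint_fan_sum_weighted {C : Type*} [Fintype C] {J : C → AbelianVariety K} {Y : AbelianVariety K}
    (π : ∀ c, Y ⟶ J c) (ι : ∀ c, J c ⟶ Y) (hιπ : ∀ c, ι c ≫ π c = 𝟙 (J c)) (hιπ' : ∀ c₁ c₂, c₁ ≠ c₂ → ι c₁ ≫ π c₂ = 0)
    (W : ∀ c, CartierDivisor (J c).X.left) (Θ : CartierDivisor Y.X.left)
    (hpair : ∀ (N : ℕ) [IsDominant (Hom.toSchemeHom ((N : ℤ) • 𝟙 Y))] [∀ c, IsDominant (Hom.toSchemeHom ((N : ℤ) • 𝟙 (J c)))]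
      (P Q : Y.torsionPoints K N),
      Y.weilPairingLevel Θ P Q =
        ∏ c, (J c).weilPairingLevel (W c) ⟨AlgPoints.map (π c).hom.hom.hom P.1, map_mem_torsionPoints (π c) P.2⟩
          ⟨AlgPoints.map (π c).hom.hom.hom Q.1, map_mem_torsionPoints (π c) Q.2⟩)
    {I : Type*} (s : Finset I) (a b : I → C) (f : ∀ i, J (a i) ⟶ J (b i)) (g : ∀ i, J (b i) ⟶ J (a i))
    (w m : I → ℕ) {D : ℕ} (hm : ∀ i ∈ s, m i * w i = D)
    (hf : ∀ i ∈ s, ∀ (N : ℕ) [IsDominant (Hom.toSchemeHom ((N : ℤ) • 𝟙 (J (a i))))] [IsDominant (Hom.toSchemeHom ((N : ℤ) • 𝟙 (J (b i))))]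
      (P : (J (a i)).torsionPoints K N) (Q : (J (b i)).torsionPoints K N),
      (J (b i)).weilPairingLevel (W (b i)) ⟨AlgPoints.map ((w i : ℤ) • f i).hom.hom.hom P.1, map_mem_torsionPoints ((w i : ℤ) • f i) P.2⟩ Q =
        (J (a i)).weilPairingLevel (W (a i)) P ⟨AlgPoints.map (g i).hom.hom.hom Q.1, map_mem_torsionPoints (g i) Q.2⟩)
    (hY : ∀ (N : ℕ) [IsDominant (Hom.toSchemeHom ((N : ℤ) • 𝟙 Y))], ∀ c, IsDominant (Hom.toSchemeHom ((N : ℤ) • 𝟙 (J c))))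
    (N : ℕ) [IsDominant (Hom.toSchemeHom ((N : ℤ) • 𝟙 Y))] (P Q : Y.torsionPoints K N) :
    Y.weilPairingLevel Θ
        ⟨AlgPoints.map ((D : ℤ) • ∑ i ∈ s, π (a i) ≫ f i ≫ ι (b i)).hom.hom.hom P.1,
          map_mem_torsionPoints ((D : ℤ) • ∑ i ∈ s, π (a i) ≫ f i ≫ ι (b i)) P.2⟩ Q =
      Y.weilPairingLevel Θ P
        ⟨AlgPoints.map (∑ i ∈ s, π (b i) ≫ ((m i : ℤ) • g i) ≫ ι (a i)).hom.hom.hom Q.1,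
          map_mem_torsionPoints (∑ i ∈ s, π (b i) ≫ ((m i : ℤ) • g i) ≫ ι (a i)) Q.2⟩ :=
  levelAdjoint_fan_sum π ι hιπ hιπ' W Θ hpair s a b f (fun i => (m i : ℤ) • g i)
    (fun i hi N _ _ P Q => levelAdjoint_weight_eq (W (a i)) (W (b i)) (hm i hi) (hf i hi) N P Q) hY N P Q

/-- **Fan sum with entrywise weights, one scalar in front.**  If the raw adjoint of entry `i` is `w i • g i` with weight `w i`
(the shape delivered by the dominated-cover letter ★ `levelAdjoint_pushforward_of_dominated`: `((d_q·deg q) • Nm_f, (d_p·deg q) • f^*)`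
with `d_p = d_q`), and `m i * w i = D` on `s`, then the adjoint of `Σ_{i ∈ s} π (a i) ≫ f i ≫ ι (b i)` of weight `D` is
`D • Σ_{i ∈ s} π (b i) ≫ g i ≫ ι (a i)` — the transposed word with ONE scalar in front (what the Hecke-word identity for `g⁻¹`
consumes). [cite: MumfordAV1970, §20 (p. 186, property (3) of e_n)] -/
theorem levelAdjoint_fan_sum_smul {C : Type*} [Fintype C] {J : C → AbelianVariety K} {Y : AbelianVariety K}
    (π : ∀ c, Y ⟶ J c) (ι : ∀ c, J c ⟶ Y) (hιπ : ∀ c, ι c ≫ π c = 𝟙 (J c)) (hιπ' : ∀ c₁ c₂, c₁ ≠ c₂ → ι c₁ ≫ π c₂ = 0)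
    (W : ∀ c, CartierDivisor (J c).X.left) (Θ : CartierDivisor Y.X.left)
    (hpair : ∀ (N : ℕ) [IsDominant (Hom.toSchemeHom ((N : ℤ) • 𝟙 Y))] [∀ c, IsDominant (Hom.toSchemeHom ((N : ℤ) • 𝟙 (J c)))]
      (P Q : Y.torsionPoints K N),
      Y.weilPairingLevel Θ P Q =
        ∏ c, (J c).weilPairingLevel (W c) ⟨AlgPoints.map (π c).hom.hom.hom P.1, map_mem_torsionPoints (π c) P.2⟩
          ⟨AlgPoints.map (π c).hom.hom.hom Q.1, map_mem_torsionPoints (π c) Q.2⟩)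
    {I : Type*} (s : Finset I) (a b : I → C) (f : ∀ i, J (a i) ⟶ J (b i)) (g : ∀ i, J (b i) ⟶ J (a i))
    (w m : I → ℕ) {D : ℕ} (hm : ∀ i ∈ s, m i * w i = D)
    (hf : ∀ i ∈ s, ∀ (N : ℕ) [IsDominant (Hom.toSchemeHom ((N : ℤ) • 𝟙 (J (a i))))] [IsDominant (Hom.toSchemeHom ((N : ℤ) • 𝟙 (J (b i))))]
      (P : (J (a i)).torsionPoints K N) (Q : (J (b i)).torsionPoints K N),
      (J (b i)).weilPairingLevel (W (b i)) ⟨AlgPoints.map ((w i : ℤ) • f i).hom.hom.hom P.1, map_mem_torsionPoints ((w i : ℤ) • f i) P.2⟩ Q =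
        (J (a i)).weilPairingLevel (W (a i)) P
          ⟨AlgPoints.map ((w i : ℤ) • g i).hom.hom.hom Q.1, map_mem_torsionPoints ((w i : ℤ) • g i) Q.2⟩)
    (hY : ∀ (N : ℕ) [IsDominant (Hom.toSchemeHom ((N : ℤ) • 𝟙 Y))], ∀ c, IsDominant (Hom.toSchemeHom ((N : ℤ) • 𝟙 (J c))))
    (N : ℕ) [IsDominant (Hom.toSchemeHom ((N : ℤ) • 𝟙 Y))] (P Q : Y.torsionPoints K N) :
    Y.weilPairingLevel Θ
        ⟨AlgPoints.map ((D : ℤ) • ∑ i ∈ s, π (a i) ≫ f i ≫ ι (b i)).hom.hom.hom P.1,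
          map_mem_torsionPoints ((D : ℤ) • ∑ i ∈ s, π (a i) ≫ f i ≫ ι (b i)) P.2⟩ Q =
      Y.weilPairingLevel Θ P
        ⟨AlgPoints.map ((D : ℤ) • ∑ i ∈ s, π (b i) ≫ g i ≫ ι (a i)).hom.hom.hom Q.1,
          map_mem_torsionPoints ((D : ℤ) • ∑ i ∈ s, π (b i) ≫ g i ≫ ι (a i)) Q.2⟩ := by
  have key := levelAdjoint_fan_sum_weighted π ι hιπ hιπ' W Θ hpair s a b f (fun i => (w i : ℤ) • g i) w m hm hf hY N P Q
  have hsum : (∑ i ∈ s, π (b i) ≫ ((m i : ℤ) • ((w i : ℤ) • g i)) ≫ ι (a i)) = (D : ℤ) • ∑ i ∈ s, π (b i) ≫ g i ≫ ι (a i) := by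
    rw [Finset.smul_sum]
    refine Finset.sum_congr rfl fun i hi => ?_
    rw [smul_smul, ← Nat.cast_mul, hm i hi, Preadditive.zsmul_comp, Preadditive.comp_zsmul]
  have eQ : (⟨AlgPoints.map (∑ i ∈ s, π (b i) ≫ ((m i : ℤ) • ((w i : ℤ) • g i)) ≫ ι (a i)).hom.hom.hom Q.1,
        map_mem_torsionPoints (∑ i ∈ s, π (b i) ≫ ((m i : ℤ) • ((w i : ℤ) • g i)) ≫ ι (a i)) Q.2⟩ : Y.torsionPoints K N) =
      ⟨AlgPoints.map ((D : ℤ) • ∑ i ∈ s, π (b i) ≫ g i ≫ ι (a i)).hom.hom.hom Q.1,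
        map_mem_torsionPoints ((D : ℤ) • ∑ i ∈ s, π (b i) ≫ g i ≫ ι (a i)) Q.2⟩ :=
    Subtype.ext (by simp only [hsum])
  rw [← eQ]
  exact key

/-! ### §4 (ed. 3) Three-letter entries: plain ≫ plain ≫ weighted -/

/-- **A plain adjoint identity is a pair of weight `1`.**  If `ē^{Θ_B}(x P, Q) = ē^{Θ_A}(P, y Q)` at every level, then `(x, y)` is a
level adjoint pair of weight `1` in the sense of ★ `AbelianVarietyLevelAdjointCalculus` (`(1 : ℤ) • x = x`).  Adapter for letters
printed without a weight (the Galois-cover letter `(q^*, Nm_q)` and the iso letter `((e⁻¹)_*, e_*)`). [cite: MumfordAV1970, §20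
(p. 186, property (3) of e_n)] -/
theorem levelAdjoint_one_of_plain {A B : AbelianVariety K} (ΘA : CartierDivisor A.X.left) (ΘB : CartierDivisor B.X.left)
    {x : A ⟶ B} {y : B ⟶ A}
    (h : ∀ (N : ℕ) [IsDominant (Hom.toSchemeHom ((N : ℤ) • 𝟙 A))] [IsDominant (Hom.toSchemeHom ((N : ℤ) • 𝟙 B))]
      (P : A.torsionPoints K N) (Q : B.torsionPoints K N),
      B.weilPairingLevel ΘB ⟨AlgPoints.map x.hom.hom.hom P.1, map_mem_torsionPoints x P.2⟩ Q =
        A.weilPairingLevel ΘA P ⟨AlgPoints.map y.hom.hom.hom Q.1, map_mem_torsionPoints y Q.2⟩)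
    (N : ℕ) [IsDominant (Hom.toSchemeHom ((N : ℤ) • 𝟙 A))] [IsDominant (Hom.toSchemeHom ((N : ℤ) • 𝟙 B))]
    (P : A.torsionPoints K N) (Q : B.torsionPoints K N) :
    B.weilPairingLevel ΘB ⟨AlgPoints.map (((1 : ℕ) : ℤ) • x).hom.hom.hom P.1, map_mem_torsionPoints (((1 : ℕ) : ℤ) • x) P.2⟩ Q =
      A.weilPairingLevel ΘA P ⟨AlgPoints.map y.hom.hom.hom Q.1, map_mem_torsionPoints y Q.2⟩ := by
  have eP : (⟨AlgPoints.map (((1 : ℕ) : ℤ) • x).hom.hom.hom P.1, map_mem_torsionPoints (((1 : ℕ) : ℤ) • x) P.2⟩ :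
        B.torsionPoints K N) = ⟨AlgPoints.map x.hom.hom.hom P.1, map_mem_torsionPoints x P.2⟩ :=
    Subtype.ext (by simp only [Nat.cast_one, one_smul])
  rw [eP]
  exact h N P Q


/-- **Plain letter then weighted letter.**  A plain letter `(x₁, y₁)` for `(Θ_A, Θ_B)` followed by a letter `(x₂, y₂)` of weight `w`
for `(Θ_B, Θ_C)` is the pair `(x₁ ≫ x₂, y₂ ≫ y₁)` of the same weight `w` for `(Θ_A, Θ_C)` (the letters applied in turn at the points
`x₁ P` and `S`).  The shape of ONE entry `q^* ≫ Nm_{T_γ}` of a Hecke push–pull word: the Galois-cover letter `(q^*, Nm_q)` then the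
dominated-cover letter ★ `levelAdjoint_pushforward_of_dominated'` (weight `d_q·deg q`, adjoint `(d_p • p^*) ≫ Nm_{q′}`).
[cite: MumfordAV1970, §20 (p. 186, property (3) of e_n)] -/
theorem levelAdjoint_comp_plain_weighted {A B C : AbelianVariety K} (ΘA : CartierDivisor A.X.left) (ΘB : CartierDivisor B.X.left)
    (ΘC : CartierDivisor C.X.left) {x₁ : A ⟶ B} {y₁ : B ⟶ A} {x₂ : B ⟶ C} {y₂ : C ⟶ B} {w : ℕ}
    (h₁ : ∀ (N : ℕ) [IsDominant (Hom.toSchemeHom ((N : ℤ) • 𝟙 A))] [IsDominant (Hom.toSchemeHom ((N : ℤ) • 𝟙 B))]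
      (P : A.torsionPoints K N) (Q : B.torsionPoints K N),
      B.weilPairingLevel ΘB ⟨AlgPoints.map x₁.hom.hom.hom P.1, map_mem_torsionPoints x₁ P.2⟩ Q =
        A.weilPairingLevel ΘA P ⟨AlgPoints.map y₁.hom.hom.hom Q.1, map_mem_torsionPoints y₁ Q.2⟩)
    (h₂ : ∀ (N : ℕ) [IsDominant (Hom.toSchemeHom ((N : ℤ) • 𝟙 B))] [IsDominant (Hom.toSchemeHom ((N : ℤ) • 𝟙 C))]
      (Q : B.torsionPoints K N) (S : C.torsionPoints K N),
      C.weilPairingLevel ΘC ⟨AlgPoints.map ((w : ℤ) • x₂).hom.hom.hom Q.1, map_mem_torsionPoints ((w : ℤ) • x₂) Q.2⟩ S =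
        B.weilPairingLevel ΘB Q ⟨AlgPoints.map y₂.hom.hom.hom S.1, map_mem_torsionPoints y₂ S.2⟩)
    (N : ℕ) [IsDominant (Hom.toSchemeHom ((N : ℤ) • 𝟙 A))] [IsDominant (Hom.toSchemeHom ((N : ℤ) • 𝟙 B))]
    [IsDominant (Hom.toSchemeHom ((N : ℤ) • 𝟙 C))] (P : A.torsionPoints K N) (S : C.torsionPoints K N) :
    C.weilPairingLevel ΘC ⟨AlgPoints.map ((w : ℤ) • (x₁ ≫ x₂)).hom.hom.hom P.1, map_mem_torsionPoints ((w : ℤ) • (x₁ ≫ x₂)) P.2⟩ S =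
      A.weilPairingLevel ΘA P ⟨AlgPoints.map (y₂ ≫ y₁).hom.hom.hom S.1, map_mem_torsionPoints (y₂ ≫ y₁) S.2⟩ := by
  have eP : (⟨AlgPoints.map ((w : ℤ) • (x₁ ≫ x₂)).hom.hom.hom P.1, map_mem_torsionPoints ((w : ℤ) • (x₁ ≫ x₂)) P.2⟩ :
        C.torsionPoints K N) =
      ⟨AlgPoints.map ((w : ℤ) • x₂).hom.hom.hom (AlgPoints.map x₁.hom.hom.hom P.1),
        map_mem_torsionPoints ((w : ℤ) • x₂) (map_mem_torsionPoints x₁ P.2)⟩ :=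
    Subtype.ext (show AlgPoints.map ((w : ℤ) • (x₁ ≫ x₂)).hom.hom.hom P.1 = _ by
      rw [← Preadditive.comp_zsmul, map_hom_comp_apply])
  rw [eP, h₂ N ⟨_, map_mem_torsionPoints x₁ P.2⟩ S, h₁ N P ⟨_, map_mem_torsionPoints y₂ S.2⟩, torsionPoints_map_comp]

/-- **Three-letter entry.**  Two plain letters `(x₁, y₁)` for `(Θ_A, Θ_B)` and `(x₂, y₂)` for `(Θ_B, Θ_C)` followed by a weighted
letter `(x₃, w′ • y₃)` of weight `w` for `(Θ_C, Θ_D)` compose to the pair `(x₁ ≫ x₂ ≫ x₃, w′ • (y₃ ≫ y₂ ≫ y₁))` of weight `w` for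
`(Θ_A, Θ_D)` (the letters applied in turn at the points `x₁ P`, `x₂ (x₁ P)`; cf. ★ `levelAdjoint_comp`).  The shape of ONE entry of a Hecke push–pull word through a deeper
level: `q^*` (Galois-cover letter) `≫ (e_γ)_*` (iso letter) `≫ Nm_{u′}` (dominated-cover letter ★ `levelAdjoint_pushforward_of_dominated`,
weight `d_q·deg q`, adjoint `(d_p·deg q) • u′^*`). [cite: MumfordAV1970, §20 (p. 186, property (3) of e_n)] -/
theorem levelAdjoint_comp₃_smul {A B C D : AbelianVariety K} (ΘA : CartierDivisor A.X.left) (ΘB : CartierDivisor B.X.left)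
    (ΘC : CartierDivisor C.X.left) (ΘD : CartierDivisor D.X.left)
    {x₁ : A ⟶ B} {y₁ : B ⟶ A} {x₂ : B ⟶ C} {y₂ : C ⟶ B} {x₃ : C ⟶ D} {y₃ : D ⟶ C} {w w' : ℕ}
    (h₁ : ∀ (N : ℕ) [IsDominant (Hom.toSchemeHom ((N : ℤ) • 𝟙 A))] [IsDominant (Hom.toSchemeHom ((N : ℤ) • 𝟙 B))]
      (P : A.torsionPoints K N) (Q : B.torsionPoints K N),
      B.weilPairingLevel ΘB ⟨AlgPoints.map x₁.hom.hom.hom P.1, map_mem_torsionPoints x₁ P.2⟩ Q =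
        A.weilPairingLevel ΘA P ⟨AlgPoints.map y₁.hom.hom.hom Q.1, map_mem_torsionPoints y₁ Q.2⟩)
    (h₂ : ∀ (N : ℕ) [IsDominant (Hom.toSchemeHom ((N : ℤ) • 𝟙 B))] [IsDominant (Hom.toSchemeHom ((N : ℤ) • 𝟙 C))]
      (Q : B.torsionPoints K N) (R : C.torsionPoints K N),
      C.weilPairingLevel ΘC ⟨AlgPoints.map x₂.hom.hom.hom Q.1, map_mem_torsionPoints x₂ Q.2⟩ R =
        B.weilPairingLevel ΘB Q ⟨AlgPoints.map y₂.hom.hom.hom R.1, map_mem_torsionPoints y₂ R.2⟩)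
    (h₃ : ∀ (N : ℕ) [IsDominant (Hom.toSchemeHom ((N : ℤ) • 𝟙 C))] [IsDominant (Hom.toSchemeHom ((N : ℤ) • 𝟙 D))]
      (R : C.torsionPoints K N) (S : D.torsionPoints K N),
      D.weilPairingLevel ΘD ⟨AlgPoints.map ((w : ℤ) • x₃).hom.hom.hom R.1, map_mem_torsionPoints ((w : ℤ) • x₃) R.2⟩ S =
        C.weilPairingLevel ΘC R ⟨AlgPoints.map ((w' : ℤ) • y₃).hom.hom.hom S.1, map_mem_torsionPoints ((w' : ℤ) • y₃) S.2⟩)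
    (N : ℕ) [IsDominant (Hom.toSchemeHom ((N : ℤ) • 𝟙 A))] [IsDominant (Hom.toSchemeHom ((N : ℤ) • 𝟙 B))]
    [IsDominant (Hom.toSchemeHom ((N : ℤ) • 𝟙 C))] [IsDominant (Hom.toSchemeHom ((N : ℤ) • 𝟙 D))]
    (P : A.torsionPoints K N) (S : D.torsionPoints K N) :
    D.weilPairingLevel ΘD
        ⟨AlgPoints.map ((w : ℤ) • (x₁ ≫ x₂ ≫ x₃)).hom.hom.hom P.1, map_mem_torsionPoints ((w : ℤ) • (x₁ ≫ x₂ ≫ x₃)) P.2⟩ S =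
      A.weilPairingLevel ΘA P
        ⟨AlgPoints.map ((w' : ℤ) • (y₃ ≫ y₂ ≫ y₁)).hom.hom.hom S.1, map_mem_torsionPoints ((w' : ℤ) • (y₃ ≫ y₂ ≫ y₁)) S.2⟩ := by
  have e : ((w : ℤ) • (x₁ ≫ x₂ ≫ x₃)) = x₁ ≫ x₂ ≫ ((w : ℤ) • x₃) := by
    rw [Preadditive.comp_zsmul, Preadditive.comp_zsmul]
  have eP : (⟨AlgPoints.map ((w : ℤ) • (x₁ ≫ x₂ ≫ x₃)).hom.hom.hom P.1, map_mem_torsionPoints ((w : ℤ) • (x₁ ≫ x₂ ≫ x₃)) P.2⟩ :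
        D.torsionPoints K N) =
      ⟨AlgPoints.map ((w : ℤ) • x₃).hom.hom.hom (AlgPoints.map x₂.hom.hom.hom (AlgPoints.map x₁.hom.hom.hom P.1)),
        map_mem_torsionPoints ((w : ℤ) • x₃) (map_mem_torsionPoints x₂ (map_mem_torsionPoints x₁ P.2))⟩ :=
    Subtype.ext (show AlgPoints.map ((w : ℤ) • (x₁ ≫ x₂ ≫ x₃)).hom.hom.hom P.1 = _ by
      rw [e, map_hom_comp_apply, map_hom_comp_apply])
  have eS : (⟨AlgPoints.map ((w' : ℤ) • (y₃ ≫ y₂ ≫ y₁)).hom.hom.hom S.1, map_mem_torsionPoints ((w' : ℤ) • (y₃ ≫ y₂ ≫ y₁)) S.2⟩ :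
        A.torsionPoints K N) =
      ⟨AlgPoints.map y₁.hom.hom.hom (AlgPoints.map y₂.hom.hom.hom (AlgPoints.map ((w' : ℤ) • y₃).hom.hom.hom S.1)),
        map_mem_torsionPoints y₁ (map_mem_torsionPoints y₂ (map_mem_torsionPoints ((w' : ℤ) • y₃) S.2))⟩ :=
    Subtype.ext (show AlgPoints.map ((w' : ℤ) • (y₃ ≫ y₂ ≫ y₁)).hom.hom.hom S.1 = _ by
      rw [← Preadditive.zsmul_comp, map_hom_comp_apply, map_hom_comp_apply])
  rw [eP, h₃ N ⟨_, map_mem_torsionPoints x₂ (map_mem_torsionPoints x₁ P.2)⟩ S,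
    h₂ N ⟨_, map_mem_torsionPoints x₁ P.2⟩ ⟨_, map_mem_torsionPoints ((w' : ℤ) • y₃) S.2⟩,
    h₁ N P ⟨_, map_mem_torsionPoints y₂ (map_mem_torsionPoints ((w' : ℤ) • y₃) S.2)⟩, eS]

end AbelianVariety

end Literature.AlgebraicGeometry.Motives

end
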